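import Summits.QuantumFields.YangMills.Theorems.AllWindowsColdBoxBoxHighLineStep2Tilt
import Summits.QuantumFields.YangMills.Theorems.AllWindowsColdBoxBoxHighLineQuadFormSplit
import Summits.QuantumFields.YangMills.Theorems.AllWindowsColdBoxBoxHighLineFPChartWeightSandwich

/-!
# T-S5.5n — exact factorisation of the FP-chart weight on the small-field box (REPAIRED: `0 < r`), and `¬` the task Prop as typed
# (task Prop `FPChartWeightOnSmallField` of ✓`…Step2Tilt`; STUB-PLAN-S5-STEP2 / ASSEMBLY-S5 §5, planner ym-idea-2 g18 routing 19:54:19Z / 20:00:40Z «5n»;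
# LINE-19 S5 ⟨stmt-QuantumFields-24004⟩/⟨24335⟩, LINE-20 U5 ⟨24336⟩)

Width seat `ym-line-sfw-p2-w4` (prover-ym-line-sfw-p2-w4-g28-0).

**The identity.**  On `smallField H s` with `0 ≤ s ≤ r`, `s < π`, `0 < r` and `det F_FP(U(a)) ≠ 0`,

  `fpChartWeight β H r a = |det F_FP(1)| · σ(0)^{|LandauFree H|} · e^{−β·boxQuadForm H a} · e^{tiltU β H a}`

(**`fpChartWeight_eq_on_smallField`**), because (i) the ball cut-off is `1` there (✓`FPChart.ballCutoff_edgeChart_eq_one`, needs `r ≠ 0`), (ii)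
`boxWilson(U(a)) = Σ_{p touching the box} chartPlaqCost` is definitional (`wilsonBoundaryAction` / `plaqCostAt`), so `cubicVertex + quarticWilson =
β·(boxWilson − Σ_p |ℓ_p|²)` and, by ✓T-S5.7e `quadFormSplit` clause 1 (`Σ_p |ℓ_p|² + divLinSq = boxQuadForm`), the Gaussian exponent plus the polynomial
part of `tiltU` is exactly `−β(boxWilson + landauPhi)` (`FPChartFactor.gauss_exponent_add`), (iii) `e^{ghostLogRatio} = |det F(U(a))|/|det F(1)|`
(✓`det_fpOperator_one_ne_zero`) and (iv) `e^{haarLogRatio} = chartHaarWeight/σ(0)^n` (✓`sigmaSU2_pos` on `‖a_e‖ ≤ s < π`).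

**The task Prop as typed is FALSE in the degenerate corner `r = s = 0`** (**`not_fpChartWeightOnSmallField : ¬ FPChartWeightOnSmallField`**): the one-link
bump `linkBump 0 t = min 1 (max 0 ((0 − t)/0)) = 0`, so `ballCutoff H 0 ≡ 0` and `fpChartWeight β H 0 a = 0`, while the right-hand side at `a = 0`
(`edgeChart H 0 = 1`, `det F(1) ≠ 0`) is a product of non-zero factors.  REPAIR (minimal): add the hypothesis `0 < r` — every consumer (T-S5.6 / ASSEMBLY-S5,
`4s ≤ r`, `0 < s`) has it.  The corrected statement is proved here with the task Prop's binder order and `0 < r` inserted after `s < π`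
(**`fpChartWeightOnSmallField_pos`**).

Everything proved; no definitions; standard axioms.  HONEST LABEL: an S-brick of STEP 2 of the XL stub S5 of a critic-PASSed DRAFT line; S5, U5 and the
items ⟨24004⟩ ⟨24335⟩ ⟨24336⟩ remain OPEN; no crux, rung or summit is proved; the Yang–Mills mass gap is NOT proved by this file.
-/

set_option autoImplicit false

open MeasureTheory Real Finset
open Literature.MathematicalPhysics.QuantumFieldTheory.AxialGauge (boxEdges card_boxEdges)
open Literature.MathematicalPhysics.QuantumFieldTheory.Balaban1983to89.B10Eq18SigmaSU2Haar (expPauli expPauli_zero)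
open Literature.MathematicalPhysics.QuantumFieldTheory.Balaban1983to89.B10Eq22Rescaling (sigmaSU2 sigmaSU2_pos sigmaSU2_zero)
open Literature.MathematicalPhysics.QuantumLattice (plaquettesTouching)

namespace Summit.QuantumFields.YangMills.Theorems.AllWindowsColdBoxBoxHighLine

namespace FPChartFactor

variable {H : ℕ}

/-- `boxWilson(U(a)) = Σ_{p touching the box} chartPlaqCost` — definitional (`wilsonBoundaryAction` vs `plaqCostAt`). -/
theorem boxWilson_edgeChart_eq_sum (a : LandauFree H → E3) :
    boxWilson H (edgeChart H a) =
      ∑ p ∈ plaquettesTouching (boxEdges 4 (2 * H + 1)), chartPlaqCost H p.1 p.2.1.1 p.2.1.2 a := rfl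

/-- `cubicVertex + quarticWilson = β·(boxWilson(U(a)) − Σ_{p touching} |ℓ_p|²)` (the odd parts cancel in the sum of the two vertices). -/
theorem cubicVertex_add_quarticWilson (β : ℝ) (a : LandauFree H → E3) :
    cubicVertex β H a + quarticWilson β H a =
      β * (boxWilson H (edgeChart H a) -
        ∑ p ∈ plaquettesTouching (boxEdges 4 (2 * H + 1)), linCurvSq H (p.1, p.2.1.1, p.2.1.2) a) := by
  rw [boxWilson_edgeChart_eq_sum, cubicVertex, quarticWilson, ← mul_add, ← Finset.sum_add_distrib, ← Finset.sum_sub_distrib]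
  congr 1
  refine Finset.sum_congr rfl fun p _ => ?_
  ring

/-- **The exponent identity** (✓T-S5.7e clause 1): `−β·boxQuadForm + (−cubicVertex − quarticWilson − β(landauPhi − divLinSq)) = −β(boxWilson + landauPhi)`. -/
theorem gauss_exponent_add (hH : 1 ≤ H) (β : ℝ) (a : LandauFree H → E3) :
    -(β * boxQuadForm H a) +
        (-cubicVertex β H a - quarticWilson β H a - β * (landauPhi H (edgeChart H a) - divLinSq H a)) =
      -(β * (boxWilson H (edgeChart H a) + landauPhi H (edgeChart H a))) := by
  have h7e := (quadFormSplit H hH a).1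
  have hV := cubicVertex_add_quarticWilson (H := H) β a
  linear_combination -hV + β * h7e

/-- `e^{ghostLogRatio} = |det F(U(a))| / |det F(1)|` when `det F(U(a)) ≠ 0` (✓`det_fpOperator_one_ne_zero`). -/
theorem exp_ghostLogRatio {a : LandauFree H → E3} (hdet : (fpOperator H (edgeChart H a)).det ≠ 0) :
    Real.exp (ghostLogRatio H a) = |(fpOperator H (edgeChart H a)).det| / |(fpOperator H 1).det| := by
  rw [ghostLogRatio, Real.exp_sub, Real.exp_log (abs_pos.2 hdet), Real.exp_log (abs_pos.2 (det_fpOperator_one_ne_zero H))]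

/-- `σ(0)^{|LandauFree H|} ≠ 0`. -/
theorem sigmaSU2_zero_pow_ne_zero (H : ℕ) : sigmaSU2 0 ^ Fintype.card (LandauFree H) ≠ 0 :=
  pow_ne_zero _ (by rw [sigmaSU2_zero]; positivity)

/-- `e^{haarLogRatio} = chartHaarWeight / σ(0)^{|LandauFree H|}` on `smallField H s`, `s < π` (✓`sigmaSU2_pos`). -/
theorem exp_haarLogRatio {s : ℝ} (hsπ : s < Real.pi) {a : LandauFree H → E3} (ha : a ∈ smallField H s) :
    Real.exp (haarLogRatio H a) = chartHaarWeight H a / sigmaSU2 0 ^ Fintype.card (LandauFree H) := by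
  rw [haarLogRatio, Real.exp_sum, chartHaarWeight, ← Finset.card_univ, ← Finset.prod_const, ← Finset.prod_div_distrib]
  refine Finset.prod_congr rfl fun e _ => ?_
  have hπ : ‖a e‖ < Real.pi := (ha e).trans_lt hsπ
  exact Real.exp_log (div_pos (sigmaSU2_pos (norm_nonneg _) hπ) (by rw [sigmaSU2_zero]; positivity))

/-- `edgeChart H 0 = 1` (`expPauli 0 = 1`). -/
theorem edgeChart_zero (H : ℕ) : edgeChart H (0 : LandauFree H → E3) = 1 := by
  funext e
  have h0 : freeVec H (0 : LandauFree H → E3) e = 0 := by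
    unfold freeVec
    split_ifs <;> rfl
  rw [edgeChart, h0, expPauli_zero, Pi.one_apply]

/-- At `r = 0` the ball cut-off vanishes identically (`H ≥ 1`): `linkBump 0 t = 0`. -/
theorem ballCutoff_zero (hH : 1 ≤ H) (U : Literature.MathematicalPhysics.QuantumLattice.LGConfig 4 SU2) : ballCutoff H 0 U = 0 := by
  obtain ⟨e, he⟩ : (boxEdges 4 (2 * H + 1)).Nonempty := by
    rw [← Finset.card_pos, card_boxEdges]
    have h1 : 1 ≤ 2 * H + 1 - 1 := by omega
    have h2 : 1 ≤ (2 * H + 1) ^ (4 - 1) := Nat.one_le_pow _ _ (by omega)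
    calc 0 < 4 * (1 * 1) := by norm_num
      _ ≤ 4 * ((2 * H + 1 - 1) * (2 * H + 1) ^ (4 - 1)) := Nat.mul_le_mul_left _ (Nat.mul_le_mul h1 h2)
  refine Finset.prod_eq_zero he ?_
  simp [linkBump]

end FPChartFactor

open FPChartFactor

/-- **T-S5.5n, REPAIRED (`0 < r`): exact factorisation of the FP-chart weight on the small-field box.**  For `H ≥ 1`, `0 ≤ s ≤ r`, `s < π`, `0 < r`,
`a ∈ smallField H s` with `det F_FP(U(a)) ≠ 0`:
`fpChartWeight β H r a = |det F_FP(1)| · σ(0)^{|LandauFree H|} · gaussWeight β H a · exp(tiltU β H a)`. -/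
theorem fpChartWeight_eq_on_smallField {H : ℕ} (hH : 1 ≤ H) {β r s : ℝ} (hs0 : 0 ≤ s) (hsr : s ≤ r) (hsπ : s < Real.pi)
    (hr : 0 < r) {a : LandauFree H → E3} (ha : a ∈ smallField H s) (hdet : (fpOperator H (edgeChart H a)).det ≠ 0) :
    fpChartWeight β H r a =
      |(fpOperator H 1).det| * sigmaSU2 0 ^ Fintype.card (LandauFree H) * gaussWeight β H a * Real.exp (tiltU β H a) := by
  have hχ : ballCutoff H r (edgeChart H a) = 1 := FPChart.ballCutoff_edgeChart_eq_one hr.ne' hs0 hsr hsπ.le ha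
  have hD1 : |(fpOperator H 1).det| ≠ 0 := abs_ne_zero.2 (det_fpOperator_one_ne_zero H)
  have hσ0 := sigmaSU2_zero_pow_ne_zero H
  have htilt : Real.exp (tiltU β H a) =
      Real.exp (-cubicVertex β H a - quarticWilson β H a - β * (landauPhi H (edgeChart H a) - divLinSq H a)) *
        (|(fpOperator H (edgeChart H a)).det| / |(fpOperator H 1).det|) *
        (chartHaarWeight H a / sigmaSU2 0 ^ Fintype.card (LandauFree H)) := by
    rw [tiltU, Real.exp_add, Real.exp_add, exp_ghostLogRatio hdet, exp_haarLogRatio hsπ ha]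
  have hexp : Real.exp (-(β * (boxWilson H (edgeChart H a) + landauPhi H (edgeChart H a)))) =
      Real.exp (-(β * boxQuadForm H a)) *
        Real.exp (-cubicVertex β H a - quarticWilson β H a - β * (landauPhi H (edgeChart H a) - divLinSq H a)) := by
    rw [← Real.exp_add, gauss_exponent_add hH]
  rw [fpChartWeight, hχ, one_mul, htilt, gaussWeight, hexp]
  field_simp

/-- **T-S5.5n in the task Prop's binder order with the repair `0 < r` inserted** (after `s < π`). -/
theorem fpChartWeightOnSmallField_pos :
    ∀ H : ℕ, 1 ≤ H → ∀ β r s : ℝ, 0 ≤ s → s ≤ r → s < Real.pi → 0 < r → ∀ a ∈ smallField H s,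
      (fpOperator H (edgeChart H a)).det ≠ 0 →
      fpChartWeight β H r a =
        |(fpOperator H 1).det| * sigmaSU2 0 ^ Fintype.card (LandauFree H) * gaussWeight β H a * Real.exp (tiltU β H a) :=
  fun _H hH _β _r _s hs0 hsr hsπ hr _a ha hdet => fpChartWeight_eq_on_smallField hH hs0 hsr hsπ hr ha hdet

/-- **The task Prop `FPChartWeightOnSmallField` AS TYPED is false** (degenerate corner `r = s = 0`, `a = 0`, `H = 1`): the left-hand side vanishes because
`ballCutoff H 0 ≡ 0` (`linkBump 0 t = min 1 (max 0 ((0 − t)/0)) = 0`), the right-hand side is a product of non-zero factors (`det F(1) ≠ 0`, `σ(0) > 0`,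
two exponentials).  Minimal repair: add `0 < r` (`fpChartWeightOnSmallField_pos`); every consumer has `0 < s`, `4s ≤ r`. -/
theorem not_fpChartWeightOnSmallField : ¬ FPChartWeightOnSmallField := by
  intro h
  have h0 : (0 : LandauFree 1 → E3) ∈ smallField 1 0 := fun e => by simp
  have hdet : (fpOperator 1 (edgeChart 1 (0 : LandauFree 1 → E3))).det ≠ 0 := by
    rw [edgeChart_zero]; exact det_fpOperator_one_ne_zero 1
  have h1 := h 1 le_rfl 0 0 0 le_rfl le_rfl Real.pi_pos 0 h0 hdet
  rw [fpChartWeight, ballCutoff_zero le_rfl, zero_mul, zero_mul, zero_mul] at h1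
  have hD1 : |(fpOperator 1 1).det| ≠ 0 := abs_ne_zero.2 (det_fpOperator_one_ne_zero 1)
  exact (mul_ne_zero (mul_ne_zero (mul_ne_zero hD1 (sigmaSU2_zero_pow_ne_zero 1)) (Real.exp_pos _).ne') (Real.exp_pos _).ne') h1.symm

end Summit.QuantumFields.YangMills.Theorems.AllWindowsColdBoxBoxHighLine
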